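import Mathlib
import Literature.Analysis.FluidPDE.TypeIAncientMildClassical
import Literature.Analysis.FluidPDE.SpaceTimeCalculus
import Literature.Analysis.FluidPDE.EnstrophySplitting
import Literature.Analysis.FluidPDE.ClassicalSolutionGlue
import Summits.NavierStokesRegularity.NavierStokesRegularity.Theorems.SqueezeCycleExtremalBiaxialitySubcriticalGaugeStrainBound
import Summits.NavierStokesRegularity.NavierStokesRegularity.Theorems.SqueezeCycleExtremalElementExistsRegularity
import Summits.NavierStokesRegularity.NavierStokesRegularity.Theorems.SqueezeCycleExtremalElementExistsRescale
import HarnessLib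

/-!
# KNSS gauge bounds for the Type-I ancient mild class (route `SymmetryModuliCount`, item
# stmt-NavierStokesRegularity-4054 `LinearLiouvilleSeven`, line `galilean-collapse`, Prop B1)

For every element `u` of the Oseen-gauge Type-I ancient mild class
`A_C = {IsTypeIAncientMild C u}` (jointly smooth on `t < 0`, divergence free, KNSS-mild,
`‖u‖ ≤ C/√(−t)`):

* `exists_isClassicalNSSolutionOn_Iio_of_typeI` — there is ONE pressure `p`, jointly smooth on
  `(−∞, 0) × ℝ³`, for which `(u, p)` is a classical Navier–Stokes solution on the whole of
  `(−∞, 0)` (the Fabes–Jones–Rivière pressures of the windows `(−n, 0)`,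
  `IsTypeIAncientMild.exists_isClassicalNSSolutionOn_Ioo`, normalised by `p(t, 0) = 0`, agree on
  overlaps — `IsClassicalNSSolutionOn.pressure_sub_apply_zero_eq_of_eventuallyEq` — and joint
  smoothness is local);
* the scale-invariant bounds `√(−t)³ ‖Δu(t)(x)‖ ≤ K₂(C)` (`exists_gauge_norm_laplacian_le_of_typeI`)
  and `√(−t)³ ‖∂ₜu(t, x)‖ ≤ L(C)` (`exists_gauge_norm_timeDeriv_le_of_typeI`), class-uniform:
  KNSS 2009 Prop. 4.1 / (4.10)–(4.11) on the window `[−2, −1/2)` (tree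
  `exists_norm_iteratedFDeriv_le_of_typeI`, `exists_lipschitz_time_of_typeI`) transported to every
  `(t, x)` by the Navier–Stokes zoom `w(s, y) = c u(c²s, x + c y)`, `c = √(−t)`
  (`isTypeIAncientMild_zoom`), exactly as the tree's gradient bound
  `exists_gauge_norm_fderiv_le_of_typeI` (`(−t)‖∇u‖ ≤ K₀(C)`);
* `exists_gaugePair_of_typeI` — consequently every `u ∈ A_C` carries a GAUGE PAIR: a smooth
  pressure with `∂ₜu + (u·∇)u = Δu − ∇p` on `t < 0`, `‖∇u‖ ≤ C₁/(−t)` and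
  `‖∇p‖ ≤ C₃/√(−t)³` (`∇p = Δu − ∂ₜu − (u·∇)u`). This is the named hypothesis `GaugeBounds` (B1)
  of the collapse `LinearLiouvilleSeven → TypeIAncientLiouville` of the line `galilean-collapse`
  (`Cruxes/LinearLiouvilleSeven/Lines/galilean-collapse.lean`), now a theorem.

## References

* G. Koch, N. Nadirashvili, G. Seregin, V. Šverák, *Liouville theorems for the Navier–Stokes
  equations and applications*, Acta Math. 203 (2009), §1 (1.2) (scaling), Prop. 4.1,
  (4.10)–(4.11) [KNSS2009].
* E. B. Fabes, B. F. Jones, N. M. Rivière, Arch. Rational Mech. Anal. 45 (1972), Thm. 2.1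
  [FabesJonesRiviere1972].
-/

noncomputable section

set_option linter.dupNamespace false -- tree namespace `Summit.<S>.<S>.Theorems` (summit = sub-problem) trips the core linter under standalone elaboration; the lakefile sets it weakly

open Set Function Filter MeasureTheory
open scoped Laplacian ContDiff Topology RealInnerProductSpace

namespace Summit.NavierStokesRegularity.NavierStokesRegularity.Theorems

open Literature.Analysis Literature.Analysis.FluidPDE

/-! ### A global smooth pressure on `(−∞, 0)` -/

/-- **A Type-I ancient mild field is a classical Navier–Stokes solution on the whole of
`(−∞, 0)`, for one jointly smooth pressure.** On each window `(−(n+1), 0)` the tree provides a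
smooth pressure `Pₙ` (Fabes–Jones–Rivière); the normalised pressures `Pₙ − Pₙ(·, 0)` agree
wherever both windows contain the time (the velocity determines `∇p`), so
`p(t, ·) := P_{⌈−t⌉}(t, ·) − P_{⌈−t⌉}(t, 0)` is jointly smooth (locally it is one of them) and
solves the momentum equation with `u` at every `t < 0`. -/
theorem exists_isClassicalNSSolutionOn_Iio_of_typeI {C : ℝ}
    {u : ℝ → EuclideanSpace ℝ (Fin 3) → EuclideanSpace ℝ (Fin 3)} (hu : IsTypeIAncientMild C u) :
    ∃ p : ℝ → EuclideanSpace ℝ (Fin 3) → ℝ, IsClassicalNSSolutionOn (Iio 0) 1 0 u p := by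
  -- window pressures
  have hwin : ∀ n : ℕ, ∃ p : ℝ → EuclideanSpace ℝ (Fin 3) → ℝ,
      IsClassicalNSSolutionOn (Ioo (-((n : ℝ) + 1)) 0) 1 0 u p := fun n =>
    hu.exists_isClassicalNSSolutionOn_Ioo (by
      have : (0 : ℝ) ≤ n := n.cast_nonneg
      linarith)
  choose P hP using hwin
  -- a window containing the time `t`
  have hN : ∀ t : ℝ, t < 0 → -((⌈-t⌉₊ : ℝ) + 1) < t := by
    intro t _
    have := Nat.le_ceil (-t)
    linarith
  set p : ℝ → EuclideanSpace ℝ (Fin 3) → ℝ := fun t x => P ⌈-t⌉₊ t x - P ⌈-t⌉₊ t 0 with hpdef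
  -- agreement with every window pressure, normalised
  have hagree : ∀ (m : ℕ) (t : ℝ), -((m : ℝ) + 1) < t → t < 0 → ∀ x,
      p t x = P m t x - P m t 0 := by
    intro m t hmt ht x
    exact (hP ⌈-t⌉₊).pressure_sub_apply_zero_eq_of_eventuallyEq (hP m)
      (Ioo_mem_nhds (hN t ht) ht) (Ioo_mem_nhds hmt ht) (Eventually.of_forall fun _ => rfl) x
  refine ⟨p, hu.contDiffOn, ?_, ?_, fun t ht => hu.isDivFree ht⟩
  · -- joint smoothness is local
    refine contDiffOn_of_locally_contDiffOn fun z hz => ?_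
    obtain ⟨t, x⟩ := z
    have ht : t < 0 := hz.1
    set m : ℕ := ⌈-t⌉₊ with hm
    refine ⟨Ioi (-((m : ℝ) + 1)) ×ˢ univ, isOpen_Ioi.prod isOpen_univ, ⟨hN t ht, mem_univ _⟩, ?_⟩
    have hset : (Iio (0 : ℝ) ×ˢ (univ : Set (EuclideanSpace ℝ (Fin 3)))) ∩ Ioi (-((m : ℝ) + 1)) ×ˢ
        univ = Ioo (-((m : ℝ) + 1)) 0 ×ˢ univ := by
      rw [prod_inter_prod, inter_self]
      congr 1
      ext τ
      simp only [mem_inter_iff, mem_Iio, mem_Ioi, mem_Ioo]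
      tauto
    rw [hset]
    refine (hP m).smooth_pressure.sub_apply_zero.congr fun z hz => ?_
    obtain ⟨τ, y⟩ := z
    have hτ : τ ∈ Ioo (-((m : ℝ) + 1)) 0 := hz.1
    exact hagree m τ hτ.1 hτ.2 y
  · -- the momentum equation at `t < 0` is that of the window `⌈-t⌉`
    intro t ht x
    have ht' : t < 0 := ht
    set m : ℕ := ⌈-t⌉₊ with hm
    have hmom := (hP m).momentum t ⟨hN t ht', ht'⟩ x
    have hD : timeDerivWithin (Iio 0) u t x = timeDerivWithin (Ioo (-((m : ℝ) + 1)) 0) u t x := by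
      simp only [timeDerivWithin_apply]
      rw [derivWithin_of_mem_nhds (Iio_mem_nhds ht'),
        derivWithin_of_mem_nhds (Ioo_mem_nhds (hN t ht') ht')]
    have hG : gradient (p t) x = gradient (P m t) x := by
      have e : p t = fun y => P m t y - P m t 0 := funext fun y => hagree m t (hN t ht') ht' y
      rw [e, gradient_sub_const]
    rw [hD, hG]
    exact hmom

/-! ### Scale-invariant bounds for `Δu` and `∂ₜu`, class-uniform -/

/-- **Class-uniform gauge bound for the Laplacian**: there is `K₂ = K₂(C)` with
`√(−t)³ ‖Δu(t)(x)‖ ≤ K₂` for every `u ∈ A_C`, `t < 0`, `x`. KNSS 2009, Prop. 4.1 / (4.10) with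
`k = 2` on the window `[−2, −1/2)` (`exists_norm_iteratedFDeriv_le_of_typeI`) bounds
`‖D²w(−1)(0)‖`, hence `‖Δw(−1)(0)‖ ≤ 3‖D²w(−1)(0)‖`, uniformly over the class; applied to the zoom
`w(s, y) = c u(c²s, x + c y)`, `c = √(−t)` (`isTypeIAncientMild_zoom`), whose Laplacian at
`(−1, 0)` is `c³ Δu(t)(x)` (`laplacian_stPull`). -/
theorem exists_gauge_norm_laplacian_le_of_typeI (C : ℝ) :
    ∃ K₂ : ℝ, ∀ ⦃u : ℝ → EuclideanSpace ℝ (Fin 3) → EuclideanSpace ℝ (Fin 3)⦄,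
      IsTypeIAncientMild C u → ∀ t < 0, ∀ x, Real.sqrt (-t) ^ 3 * ‖(Δ (u t)) x‖ ≤ K₂ := by
  obtain ⟨K, hK⟩ := exists_norm_iteratedFDeriv_le_of_typeI C 2 (a := -3) (b := -(1 / 2))
    (δ := 1) (by norm_num) (by norm_num) one_pos
  refine ⟨3 * K, fun u hu t ht x => ?_⟩
  set c : ℝ := Real.sqrt (-t) with hcdef
  have hc : 0 < c := Real.sqrt_pos.2 (neg_pos.2 ht)
  have hc2 : c ^ 2 = -t := Real.sq_sqrt (neg_pos.2 ht).le
  have ht1 : (0 : ℝ) + c ^ 2 * (-1) = t := by rw [hc2]; ring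
  -- the zoomed field is in the class
  have hw : IsTypeIAncientMild C (c • stPull (c ^ 2) c 0 x u) := isTypeIAncientMild_zoom hu hc x
  -- KNSS (4.10), `k = 2`, at `(-1, 0)` for the zoomed field
  have h := hK hw.continuousOn_uncurry (fun s hs => hw.isWeaklyDivFree hs)
    (fun s r hsr hr y => hw.mild_eq_heatExtension hsr hr y) hw.hasTypeITimeDecay (-1)
    ⟨by norm_num, by norm_num⟩ 0
  have hw2 : ContDiff ℝ 2 ((c • stPull (c ^ 2) c 0 x u) (-1)) :=
    (hw.contDiff_slice (by norm_num)).of_le (by norm_cast)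
  have hΔw := (norm_laplacian_le_three_mul_norm_iteratedFDeriv_two hw2 0).trans
    (mul_le_mul_of_nonneg_left h (by norm_num))
  -- `Δw(-1)(0) = c³ Δu(t)(x)`
  have hut2 : ContDiff ℝ 2 (u (0 + c ^ 2 * (-1))) := by
    rw [ht1]; exact (hu.contDiff_slice ht).of_le (by norm_cast)
  have hst2 : ContDiff ℝ 2 (stPull (c ^ 2) c 0 x u (-1)) := by
    have e : stPull (c ^ 2) c 0 x u (-1) = fun y => u (0 + c ^ 2 * (-1)) (x + c • y) := rfl
    rw [e]
    exact hut2.comp (contDiff_const.add (contDiff_id.const_smul c))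
  have key : (Δ ((c • stPull (c ^ 2) c 0 x u) (-1))) 0 = c ^ 3 • (Δ (u t)) x := by
    rw [show (c • stPull (c ^ 2) c 0 x u) (-1) = c • stPull (c ^ 2) c 0 x u (-1) from rfl,
      InnerProductSpace.laplacian_smul c hst2.contDiffAt, laplacian_stPull _ _ _ _ _ _ _ hut2,
      ht1, smul_zero, add_zero, smul_smul]
    ring_nf
  rw [key, norm_smul, Real.norm_of_nonneg (by positivity)] at hΔw
  exact hΔw

/-- **Class-uniform gauge bound for the time derivative**: there is `L = L(C)` with
`√(−t)³ ‖∂ₜu(t, x)‖ ≤ L` for every `u ∈ A_C`, `t < 0`, `x`. KNSS 2009, (4.11) with `k = 0` on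
the window `[−2, −1/2)` (`exists_lipschitz_time_of_typeI`) makes `s ↦ w(s, 0)` `L`-Lipschitz
there, so `‖∂ₛw(−1, 0)‖ ≤ L` (converse mean value inequality), uniformly over the class; applied
to the zoom `w(s, y) = c u(c²s, x + c y)`, `c = √(−t)`, whose time derivative at `(−1, 0)` is
`c³ ∂ₜu(t, x)` (`timeDeriv_stPull`). -/
theorem exists_gauge_norm_timeDeriv_le_of_typeI (C : ℝ) :
    ∃ L : ℝ, ∀ ⦃u : ℝ → EuclideanSpace ℝ (Fin 3) → EuclideanSpace ℝ (Fin 3)⦄,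
      IsTypeIAncientMild C u → ∀ t < 0, ∀ x, Real.sqrt (-t) ^ 3 * ‖timeDeriv u t x‖ ≤ L := by
  obtain ⟨L, hL0, hL⟩ := exists_lipschitz_time_of_typeI C 0 (a := -3) (b := -(1 / 2)) (δ := 1)
    (by norm_num) (by norm_num) one_pos
  refine ⟨L, fun u hu t ht x => ?_⟩
  set c : ℝ := Real.sqrt (-t) with hcdef
  have hc : 0 < c := Real.sqrt_pos.2 (neg_pos.2 ht)
  have hc2 : c ^ 2 = -t := Real.sq_sqrt (neg_pos.2 ht).le
  have ht1 : (0 : ℝ) + c ^ 2 * (-1) = t := by rw [hc2]; ring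
  set w : ℝ → EuclideanSpace ℝ (Fin 3) → EuclideanSpace ℝ (Fin 3) := c • stPull (c ^ 2) c 0 x u
    with hwdef
  have hw : IsTypeIAncientMild C w := isTypeIAncientMild_zoom hu hc x
  -- `s ↦ w(s, 0)` is `L`-Lipschitz on `[-2, -1/2)` about `s = -1`
  have hlip : ∀ s ∈ Ico (-2 : ℝ) (-(1 / 2)), ‖w s 0 - w (-1) 0‖ ≤ L * ‖s - (-1)‖ := by
    intro s hs
    have h := hL hw.continuousOn_uncurry (fun s hs => hw.isWeaklyDivFree hs)
      (fun s r hsr hr y => hw.mild_eq_heatExtension hsr hr y) hw.hasTypeITimeDecay (-1)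
      ⟨by norm_num, by norm_num⟩ s ⟨by linarith [hs.1], by linarith [hs.2]⟩ 0
    have e : ‖iteratedFDeriv ℝ 0 (w s) 0 - iteratedFDeriv ℝ 0 (w (-1)) 0‖ = ‖w s 0 - w (-1) 0‖ := by
      rw [iteratedFDeriv_zero_eq_comp, iteratedFDeriv_zero_eq_comp, Function.comp_apply,
        Function.comp_apply, ← map_sub, LinearIsometryEquiv.norm_map]
    rw [e, ← Real.norm_eq_abs] at h
    exact h
  -- hence `‖∂ₛ w(-1, 0)‖ ≤ L`
  have hder : ‖deriv (fun s => w s 0) (-1)‖ ≤ L := by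
    refine norm_deriv_le_of_lip' hL0 ?_
    filter_upwards [Ico_mem_nhds (show (-2 : ℝ) < -1 by norm_num)
      (show (-1 : ℝ) < -(1 / 2) by norm_num)] with s hs
    exact hlip s hs
  -- `∂ₛ w(-1, 0) = c³ ∂ₜu(t, x)`
  have huS : IsSmoothSpaceTimeOn (Iio 0) u := hu.contDiffOn
  have hdiffu : DifferentiableAt ℝ (fun r => u r (x + c • (0 : EuclideanSpace ℝ (Fin 3))))
      (0 + c ^ 2 * (-1)) := by
    rw [ht1]
    exact (huS.differentiableWithinAt_time ht _).differentiableAt (Iio_mem_nhds ht)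
  have hdiffst : DifferentiableAt ℝ (fun s => stPull (c ^ 2) c 0 x u s 0) (-1) := by
    have e : (fun s => stPull (c ^ 2) c 0 x u s 0) =
        (fun r => u r (x + c • (0 : EuclideanSpace ℝ (Fin 3)))) ∘ fun s : ℝ => 0 + c ^ 2 * s := rfl
    rw [e]
    exact hdiffu.comp (-1) ((differentiableAt_const _).add
      ((differentiableAt_const _).mul differentiableAt_id))
  have key : deriv (fun s => w s 0) (-1) = c ^ 3 • timeDeriv u t x := by
    have e : (fun s => w s 0) = fun s => c • stPull (c ^ 2) c 0 x u s 0 := rfl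
    rw [e, deriv_fun_const_smul c hdiffst, ← timeDeriv_apply (stPull (c ^ 2) c 0 x u) (-1) 0,
      timeDeriv_stPull, ht1, smul_zero, add_zero, smul_smul]
    ring_nf
  rw [key, norm_smul, Real.norm_of_nonneg (by positivity)] at hder
  exact hder

/-! ### The gauge pair -/

/-- **Every element of `A_C` carries a gauge pair** (Prop B1 `GaugeBounds` of the line
`galilean-collapse`, now a theorem): a pressure `p`, jointly smooth on `(−∞, 0) × ℝ³`, with the
classical momentum equation `∂ₜu + (u·∇)u = Δu − ∇p` on `t < 0` (two-sided `∂ₜ`), and the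
scale-invariant bounds `‖∇u(t)(x)‖ ≤ C₁/(−t)`, `‖∇p(t, x)‖ ≤ C₃/√(−t)³`
(`∇p = Δu − ∂ₜu − (u·∇)u` and the three class-uniform gauge bounds). -/
theorem exists_gaugePair_of_typeI {C : ℝ}
    {u : ℝ → EuclideanSpace ℝ (Fin 3) → EuclideanSpace ℝ (Fin 3)} (hu : IsTypeIAncientMild C u) :
    ∃ (p : ℝ → EuclideanSpace ℝ (Fin 3) → ℝ) (C₁ C₃ : ℝ),
      ContDiffOn ℝ (⊤ : ℕ∞) (uncurry p) (Iio 0 ×ˢ univ) ∧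
      (∀ t < 0, ∀ x, timeDeriv u t x + convect (u t) (u t) x = (Δ (u t)) x - gradient (p t) x) ∧
      (∀ t < 0, ∀ x, ‖fderiv ℝ (u t) x‖ ≤ C₁ / (-t)) ∧
      (∀ t < 0, ∀ x, ‖gradient (p t) x‖ ≤ C₃ / Real.sqrt (-t) ^ 3) := by
  obtain ⟨p, hp⟩ := exists_isClassicalNSSolutionOn_Iio_of_typeI hu
  obtain ⟨K₀, hK₀⟩ := exists_gauge_norm_fderiv_le_of_typeI C
  obtain ⟨K₂, hK₂⟩ := exists_gauge_norm_laplacian_le_of_typeI C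
  obtain ⟨L, hL⟩ := exists_gauge_norm_timeDeriv_le_of_typeI C
  have hC0 : 0 ≤ C := hu.nonneg
  -- the momentum equation with the two-sided time derivative
  have hmom : ∀ t < 0, ∀ x,
      timeDeriv u t x + convect (u t) (u t) x = (Δ (u t)) x - gradient (p t) x := by
    intro t ht x
    have h := hp.momentum t ht x
    rw [timeDerivWithin_eq_deriv isOpen_Iio ht, ← timeDeriv_apply, one_smul, Pi.zero_apply,
      Pi.zero_apply, add_zero] at h
    exact h
  refine ⟨p, K₀, K₂ + L + K₀ * C, hp.smooth_pressure, hmom, fun t ht x => ?_, fun t ht x => ?_⟩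
  · -- `‖∇u‖ ≤ K₀/(−t)`
    have hnt : 0 < -t := neg_pos.2 ht
    rw [le_div_iff₀ hnt, mul_comm]
    exact hK₀ hu t ht x
  · -- `‖∇p‖ ≤ (K₂ + L + K₀ C)/√(−t)³`
    have hnt : 0 < -t := neg_pos.2 ht
    have hst : 0 < Real.sqrt (-t) := Real.sqrt_pos.2 hnt
    have hs3 : 0 < Real.sqrt (-t) ^ 3 := by positivity
    have hsq : Real.sqrt (-t) ^ 2 = -t := Real.sq_sqrt hnt.le
    have hs3eq : Real.sqrt (-t) ^ 3 = (-t) * Real.sqrt (-t) := by rw [pow_succ, hsq]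
    have e : gradient (p t) x = (Δ (u t)) x - timeDeriv u t x - convect (u t) (u t) x := by
      have h := hmom t ht x
      rw [sub_sub, h]
      abel
    have h1 : Real.sqrt (-t) ^ 3 * ‖(Δ (u t)) x‖ ≤ K₂ := hK₂ hu t ht x
    have h2 : Real.sqrt (-t) ^ 3 * ‖timeDeriv u t x‖ ≤ L := hL hu t ht x
    have h3 : Real.sqrt (-t) ^ 3 * ‖convect (u t) (u t) x‖ ≤ K₀ * C := by
      have hDu : (-t) * ‖fderiv ℝ (u t) x‖ ≤ K₀ := hK₀ hu t ht x
      have hu0 : ‖u t x‖ ≤ C / Real.sqrt (-t) := hu.norm_le ht x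
      have hu1 : Real.sqrt (-t) * ‖u t x‖ ≤ C := by
        rw [le_div_iff₀ hst] at hu0
        linarith [mul_comm (Real.sqrt (-t)) ‖u t x‖]
      have hK00 : 0 ≤ K₀ := (mul_nonneg hnt.le (norm_nonneg _)).trans hDu
      calc Real.sqrt (-t) ^ 3 * ‖convect (u t) (u t) x‖
          = Real.sqrt (-t) ^ 3 * ‖fderiv ℝ (u t) x (u t x)‖ := by rw [convect_apply]
        _ ≤ Real.sqrt (-t) ^ 3 * (‖fderiv ℝ (u t) x‖ * ‖u t x‖) :=
            mul_le_mul_of_nonneg_left (ContinuousLinearMap.le_opNorm _ _) hs3.le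
        _ = ((-t) * ‖fderiv ℝ (u t) x‖) * (Real.sqrt (-t) * ‖u t x‖) := by
            rw [hs3eq]; ring
        _ ≤ K₀ * C := mul_le_mul hDu hu1 (by positivity) hK00
    have htri : ‖(Δ (u t)) x - timeDeriv u t x - convect (u t) (u t) x‖ ≤
        ‖(Δ (u t)) x‖ + ‖timeDeriv u t x‖ + ‖convect (u t) (u t) x‖ :=
      (norm_sub_le _ _).trans (add_le_add (norm_sub_le _ _) le_rfl)
    have hnorm : ‖gradient (p t) x‖ ≤
        ‖(Δ (u t)) x‖ + ‖timeDeriv u t x‖ + ‖convect (u t) (u t) x‖ := by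
      rw [e]; exact htri
    have hmul : ‖gradient (p t) x‖ * Real.sqrt (-t) ^ 3 ≤
        (‖(Δ (u t)) x‖ + ‖timeDeriv u t x‖ + ‖convect (u t) (u t) x‖) * Real.sqrt (-t) ^ 3 :=
      mul_le_mul_of_nonneg_right hnorm hs3.le
    have hdist : (‖(Δ (u t)) x‖ + ‖timeDeriv u t x‖ + ‖convect (u t) (u t) x‖) *
        Real.sqrt (-t) ^ 3 = Real.sqrt (-t) ^ 3 * ‖(Δ (u t)) x‖ +
          Real.sqrt (-t) ^ 3 * ‖timeDeriv u t x‖ + Real.sqrt (-t) ^ 3 * ‖convect (u t) (u t) x‖ := by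
      ring
    have key : ‖gradient (p t) x‖ * Real.sqrt (-t) ^ 3 ≤ K₂ + L + K₀ * C := by
      rw [hdist] at hmul
      linarith
    exact (le_div_iff₀ hs3).2 key

/-- **Registered stub `stub_gaugeBounds` of item stmt-NavierStokesRegularity-4054 (Prop B1
`GaugeBounds` of the line `galilean-collapse`)**, in its registered form: every element of `A_C`
carries a gauge pair (`exists_gaugePair_of_typeI`). -/
theorem stub_gaugeBounds :
    ∀ (C : ℝ) (u : ℝ → EuclideanSpace ℝ (Fin 3) → EuclideanSpace ℝ (Fin 3)),
      Literature.Analysis.FluidPDE.IsTypeIAncientMild C u →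
      ∃ (p : ℝ → EuclideanSpace ℝ (Fin 3) → ℝ) (C₁ C₃ : ℝ),
        ContDiffOn ℝ (⊤ : ℕ∞) (Function.uncurry p) (Set.Iio 0 ×ˢ Set.univ) ∧
        (∀ t < 0, ∀ x, Literature.Analysis.FluidPDE.timeDeriv u t x +
          Literature.Analysis.FluidPDE.convect (u t) (u t) x =
            Laplacian.laplacian (u t) x - gradient (p t) x) ∧
        (∀ t < 0, ∀ x, ‖fderiv ℝ (u t) x‖ ≤ C₁ / (-t)) ∧
        (∀ t < 0, ∀ x, ‖gradient (p t) x‖ ≤ C₃ / Real.sqrt (-t) ^ 3) :=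
  fun _ _ hu => exists_gaugePair_of_typeI hu

end Summit.NavierStokesRegularity.NavierStokesRegularity.Theorems

end
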